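import Summits.QuantumFields.YangMills.Theorems.BalabanUVNodesK0AxJoinTGeomBCore
import Summits.QuantumFields.YangMills.Theorems.BalabanUVNodesK0AxJoinTGeomA

/-!
# K0ᴬ JOIN-T, GEOMETRY HAND β — the LARGE-OR-FAR rows (G1) + (G2) of `kstep_joinT_at_record` AT THE RECORD NAMES, PROVED

Cell `ym-nodeO-ideate`, helper-hand seat `ymgap-nodeO-hand-geomB` (gen 0; ladder-directors R657-ym, director-ym №533 (3) ∕ №535, ◆ CRIT-1 g36 cut of JOIN-T v2
`nodeO-cover/LENS-1g9-JoinT-v2.lean` b7b49705adbb81b3, nodeO STATUS l.4915 (A)(D)); `--supports stmt-QuantumFields-27238 --as helper`; count-neutral.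
[I] = [Balaban1987RG1].  Sibling: hand α's ✓`…K0AxJoinTGeomA` ((G0)(G3)(G4) + `kstep_joinT_at_record_geomA`), whose displayed (G1)(G2) slots this file fills.

WHAT THIS FILE IS.  The tree's ✓`K0AxJoinT.kstep_joinT_at_record` (JOIN-T v2 §K, ✓`…K0AxJoinTKStep`) displays two LARGE-OR-FAR rows at the record names: (G1) (binder
:692–695) every domain of the centred wrap class `recordWrapCtr` satisfies `Rsep k n ≤ dist(e K μ z, X) + Mg·(d_j(X) + c₁)` for every inner-window label
(`2|z_i| < Nin k n`), and (G2) (binder :696–701) the same for every member-`(n+1)` domain that is NOT the centred image `recordDomEmbCtr X` of a non-wrap domain.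
◆ CRIT-1 g36 graded both «RECORD FACT, size M+» at `Nin := recordRNat`, `Rsep := recordR∕2 − 2·Mc`, `Mg ≥ 4·Mc` (de-risk l.4957: true for every `Mg ≥ Mc`, `c₁ ≥ 0`) and listed the ingredients ((D): nearest cube,
seam cube, `idxDist` triangle inequality, `diam ≤ torusTreeLen` in cube units, `cubeIdxOf ∘ siteOfInt` coordinate bound, interior-preimage lemma).  ALL OF THEM ARE
PROVED (the lemmas in the sibling CORE file ✓`…K0AxJoinTGeomBCore`, the rows HERE), and the two rows follow — in a GENERAL form (any `Nin ≤ recordRNat`,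
any `Rsep` with `Rsep + Nin∕2 + 2Mc ≤ recordR`, `Mg ≥ Mc`, `c₁ ≥ 0`, admissible letter `McGuard F Mc`) and AT THE RECORD CHOICE, each stated as the binder's text verbatim:

* §1–§5 = the sibling ✓`…K0AxJoinTGeomBCore` (imported): the `pabs` dictionary for `idxDist` and its triangle inequality, ★ the member-pair bound
  `idxDist_le_torusTreeLen` (`idxDist ≤ d·d_j + d`), ★ the label's cube `mul_pabs_cubeIdxOf_recordE_le` (`Mc·|cubeIdx_i|_q + 1 ≤ |z_i| + Mc`), the range arithmetic, and ★★ the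
  CORE ESTIMATE `mul_le_distD_of_far_cube`: a domain owning a cube `c` with `|c_i|_q ≥ D` has `Mc·D ≤ dist(e K μ z, X) + 4Mc·d_j(X) + 4Mc + |z_i| + Mc − 1` for every label with
  `2|z_i| < N`.
* §6 ★★ the ONE-COORDINATE CORE `mul_le_distD_of_far_cube_coord` (◆'s chain l.4957 (ii)–(iv); the sharp form of the CORE file's ℓ¹ estimate): a domain owning a cube `c` with
  `|c_i|_q ≥ D` has `Mc·D ≤ dist(e K μ z, X) + Mc·d_j(X) + Mc + |z_i| + Mc − 1` for every label with `2|z_i| < N` (triangle on the `i`-th coordinate circle through the nearest cube).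
  ★★ (G1): a wrap-class domain owns a SEAM cube (`|c_i|_q = ⌊q∕2⌋`, `Mc·⌊q∕2⌋ = recordR`) ⟹ `largeOrFar_of_mem_recordWrapCtr` (one volume) ⟹ ★★★ `rowG1_largeOrFar_wrap`
  (binder :692–695 verbatim, general `Nin ∕ Rsep`) — via the budget `largeOrFar_arith` (margin `3∕2`).
* §7 ★★ THE INTERIOR-PREIMAGE LEMMA `exists_recordDomEmbCtr_eq_of_interior`: a member-`(n+1)` domain all of whose cube indices have minimal representatives strictly
  inside the centred window of `T_K` off its seam IS `recordDomEmbCtr X` of a non-wrap `X` (EVERY volume, no tiling guard; its coordinatewise `valMinAbs`-projection; wall-connected by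
  ✓`valMinAbs_add_one_of_ne_half`, lifted back by `ZMod.coe_valMinAbs`, ✓`recordDomEmbCtr_val_of_not_mem`); hence a NON-image domain owns a cube with `|c′_i|_{q′} ≥ ⌊q∕2⌋`
  (`exists_far_cube_of_not_image`), §5 at volume `K + 1` ⟹ `largeOrFar_of_not_image` ⟹ ★★★ `rowG2_largeOrFar_notImage` (binder :696–701 verbatim, general `Nin ∕ Rsep`).
* §8 THE RECORD CHOICE: `recordChoice_budget` (`(recordR∕2 − 2Mc) + recordRNat∕2 + Mc = recordR − Mc ≤ recordR`), ★★★ `rowG1_at_recordChoice` ∕ ★★★ `rowG2_at_recordChoice` =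
  EXACTLY the two hypotheses left displayed as `hsepW ∕ hsepF` by hand α's ✓`kstep_joinT_at_record_geomA` (the budget is met with equality: `recordR∕2 − 2Mc + recordRNat∕2 + 2Mc = recordR`).
* §9 ★★★ `kstep_joinT_at_record_geomAB` — THE FIT, KERNEL-CHECKED: ✓`kstep_joinT_at_record_geomA` with (G1)(G2) DISCHARGED (one `exact`) under the two free letters' guards
  `Mc ≤ Mg`, `0 ≤ c₁`; what remains displayed is D1 (⁸'s `FormatPlusG` mould on `]0, γ₀]`-runs), the swap row to `ιC`, D9 `Response9DAtJC` + D13, and the leaves;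
  conclusion [E] `RecordPvolTwoVolExpOnRunsAx F a₀ ε₂₉ γ₀ (48E₀C₉²K₀′K₁ + 32E₀C₉²e^{δ₁Mg c₁}K₀′K₁) (δ₁ ∕ 16)`, `δ₁ = delta1 δ₀ κ Mg`.

WHY THE ROWS ARE TRUE (second reading, ◆ l.4915 (A)): an inner-window label sits at index distance `≤ (|z_i| + Mc − 1)∕Mc < Nin∕(2Mc) + 1` from the base cube in EVERY
coordinate, a seam cube at `⌊q∕2⌋` in SOME coordinate; the honest physical separation is `≈ recordR − Nin∕2`, and the rows ask a fraction of it: a seam cube is SMALL but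
FAR, a long domain reaching the window is NEAR but LARGE (`Mc·(d_j + 1)` bounds the `i`-th extent across it).  No «wrap domains are large» claim is made or needed; ◆'s v1 killer family
(singleton ∕ pair seam polymers, `d_j = 0`) sits at `distD ≥ recordR∕2 − (3∕2)·Mc > Rsep`, as the de-risk note computed.

HONEST FRAMING.  Elementary torus ∕ integer bookkeeping about the record NAMES (helper rows of the NODE O record-format programme — registry bookkeeping for
director-ym, NOT a proof of anything of Bałaban's): nothing of [I] is asserted, ported, discharged or refuted; [E] is inhabited nowhere by this file (D1, D9's decay,
D13 via P0 are OPEN content, displayed); K0ᴬ stmt-QuantumFields-27238 OPEN; NODE O 0∕1; COUNT 8∕28 · K 1∕4 UNMOVED; finite `𝕋⁴_{L^K}` at fixed ε — NOT continuum ∕ OS ∕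
Clay; **the Yang–Mills mass gap is NOT proved by any of this.**  No `sorry`, no `def`, no `instance`, no `notation`; standard axioms.
-/

noncomputable section

open scoped BigOperators

namespace Summit.QuantumFields.YangMills.Theorems.K0AxJoinTGeomB

open Literature.MathematicalPhysics.QuantumFieldTheory.Balaban1983to89
open Literature.MathematicalPhysics.QuantumFieldTheory.Balaban1983to89.Node00
open Literature.MathematicalPhysics.QuantumFieldTheory.Balaban1983to89.T4Continuum (T4Family)
open Literature.MathematicalPhysics.QuantumFieldTheory.Balaban1983to89.TreeLengthTorus (TPt IsTDom TFaceConnected TLinked TAdj torusTreeLen)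
open Literature.MathematicalPhysics.QuantumFieldTheory.Balaban1983to89.B12Decay510Torus (pabs pabs_nonneg pabs_add_le pabs_sub_comm)
open Summit.QuantumFields.YangMills.Theorems.K0RecordFormatNames

variable {F : T4Family}

/-! ## §6  (G1) THE WRAP CLASS IS LARGE-OR-FAR FROM THE INNER WINDOW -/

/-- A seam cube of the centred window is at torus distance `⌊q∕2⌋` from `0` in its seam coordinate. [cite: Balaban1987RG1, (1.21) p.264 (bookkeeping)] -/
theorem pabs_eq_half_of_valMinAbs_eq {q : ℕ} (x : ZMod q) (hx : x.valMinAbs = ((q / 2 : ℕ) : ℤ)) : pabs x = ((q / 2 : ℕ) : ℤ) := by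
  unfold pabs
  rw [hx]
  exact abs_of_nonneg (Int.natCast_nonneg _)

/-- `recordR = Mc · ⌊q∕2⌋` as a product of casts. [cite: Balaban1987RG1, (1.21) p.264 (bookkeeping)] -/
theorem recordR_eq_mul (Mc k K : ℕ) : recordR F Mc k K = (Mc : ℝ) * ((Sect2.domCount (F.P K) Mc (k + 1) / 2 : ℕ) : ℝ) := rfl

/-- The window guard `2|z_i| < Nin` in `ℝ`: `2|z_i| + 1 ≤ Nin`. [folklore] -/
theorem two_mul_abs_cast_add_one_le {a : ℤ} {Nin : ℕ} (h : 2 * |a| < (Nin : ℤ)) : 2 * |(a : ℝ)| + 1 ≤ (Nin : ℝ) := by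
  have h' : 2 * |a| + 1 ≤ (Nin : ℤ) := by omega
  have h'' : ((2 * |a| + 1 : ℤ) : ℝ) ≤ ((Nin : ℤ) : ℝ) := by exact_mod_cast h'
  simpa [Int.cast_abs] using h''

/-- ★★ **ONE-COORDINATE CORE** (the sharp form of the CORE file's `mul_le_distD_of_far_cube`, ◆ CRIT-1 g36's chain l.4957 (ii)–(iv)): on the exactly-tiled range, if a domain
`X ∈ 𝐃_{k+1}(T_K)` owns a cube `c` whose `i`-th index is at torus distance `≥ D` from `0`, then for every label `e K μ z` with `2|z_i| < N`:
`Mc·D ≤ dist(e K μ z, X) + Mc·d_j(X) + Mc + |z_i| + Mc − 1` — the triangle inequality ON THE `i`-TH COORDINATE CIRCLE through the nearest cube `p` and `c`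
(`|c_i| ≤ |a_i − p_i| + |p_i − c_i| + |a_i|`, `a` = the label's cube), `|a_i − p_i|_q ≤ idxDist a p = distD∕Mc`, the one-coordinate capture `|p_i − c_i|_q ≤ d_j(X) + 1`
(`pabs_sub_le_torusTreeLen_add_one`) and the label's cube `Mc·|a_i|_q + 1 ≤ |z_i| + Mc`. [cite: Balaban1987RG1, §0 p.257, (1.21) p.264] -/
theorem mul_le_distD_of_far_cube_coord {Mc k K : ℕ} (hMc : McGuard F Mc) (hK : recordK₀ F Mc k ≤ K) (X : (recordDomSys F Mc k K).Dom)
    {c : TPt (F.P K).d (Sect2.domCount (F.P K) Mc (k + 1))} (hc : c ∈ (X.1 : Finset _)) (i : Fin (F.P K).d) {D : ℕ} (hD : (D : ℤ) ≤ pabs (c i))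
    (μ : Fin 4) (z : Fin 4 → ℤ) (hz : 2 * |z (Fin.cast (F.P_d K) i)| < (recordN F k K : ℤ)) :
    (Mc : ℝ) * D ≤ (recordSiteGeom F Mc k K).distD (recordE F k K μ z) X + Mc * (recordDomSys F Mc k K).dj X + Mc
      + |(z (Fin.cast (F.P_d K) i) : ℝ)| + Mc - 1 := by
  classical
  set l := recordE F k K μ z with hl
  set a := cubeIdxOf F Mc k K l.2 with ha
  set p := recordPick F Mc k K l X with hp
  have hpX : p ∈ (X.1 : Finset _) := (recordPick_spec F Mc k K l X).1
  rw [recordSiteGeom_distD_eq, recordDomSys_dj_eq]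
  have hMc0 : (0 : ℝ) ≤ Mc := Nat.cast_nonneg _
  have h1 : (pabs (c i) : ℝ) ≤ pabs (a i - p i) + pabs (p i - c i) + pabs (a i) := by
    have h := pabs_add_le (c i - a i) (a i)
    have h' := pabs_add_le (a i - p i) (p i - c i)
    rw [sub_add_cancel, pabs_sub_comm] at h
    rw [sub_add_sub_cancel] at h'
    have h2 : (pabs (c i) : ℝ) ≤ pabs (a i - c i) + pabs (a i) := by exact_mod_cast h
    have h3 : (pabs (a i - c i) : ℝ) ≤ pabs (a i - p i) + pabs (p i - c i) := by exact_mod_cast h'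
    linarith
  have h2 : (pabs (a i - p i) : ℝ) ≤ idxDist a p := pabs_le_idxDist a p i
  have h3 : (pabs (p i - c i) : ℝ) ≤ torusTreeLen X.1 + 1 := pabs_sub_le_torusTreeLen_add_one X.2.1 X.2.2 hpX hc i
  have h5 : (Mc : ℝ) * pabs (a i) + 1 ≤ |(z (Fin.cast (F.P_d K) i) : ℝ)| + Mc := by
    have h := mul_pabs_cubeIdxOf_recordE_le hMc hK μ z i hz
    have h' : ((Mc : ℤ) : ℝ) * ((pabs (cubeIdxOf F Mc k K (recordE F k K μ z).2 i) : ℤ) : ℝ) + 1 ≤ ((|z (Fin.cast (F.P_d K) i)| : ℤ) : ℝ) + Mc := by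
      exact_mod_cast h
    rw [Int.cast_abs] at h'
    simpa [ha, hl] using h'
  have hD' : (D : ℝ) ≤ pabs (c i) := by exact_mod_cast hD
  have e1 : (Mc : ℝ) * D ≤ Mc * pabs (c i) := mul_le_mul_of_nonneg_left hD' hMc0
  have e2 : (Mc : ℝ) * pabs (c i) ≤ Mc * (idxDist a p + (torusTreeLen X.1 + 1)) + Mc * pabs (a i) := by
    have : (pabs (c i) : ℝ) ≤ idxDist a p + (torusTreeLen X.1 + 1) + pabs (a i) := by linarith
    nlinarith
  nlinarith

/-- **The LARGE-OR-FAR budget**: from the one-coordinate core `R ≤ dist + Mc·d_j + Mc + |z_i| + Mc − 1`, the window guard `2|z_i| + 1 ≤ Nin`, `Mg ≥ Mc`, `c₁ ≥ 0` and the separation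
budget `Rsep + Nin∕2 + 2Mc ≤ R`: `Rsep ≤ dist + Mg·(d_j + c₁)` (margin `3∕2`). [folklore] -/
theorem largeOrFar_arith {Mc Nin : ℕ} {Mg c₁ R Rsep dist dj a : ℝ} (hMg : (Mc : ℝ) ≤ Mg) (hc₁ : 0 ≤ c₁) (hdj : 0 ≤ dj)
    (hRsep : Rsep + (Nin : ℝ) / 2 + 2 * Mc ≤ R) (ha : 2 * a + 1 ≤ (Nin : ℝ)) (hcore : R ≤ dist + Mc * dj + Mc + a + Mc - 1) :
    Rsep ≤ dist + Mg * (dj + c₁) := by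
  have hMc0 : (0 : ℝ) ≤ Mc := Nat.cast_nonneg _
  have h1 : (Mc : ℝ) * dj ≤ Mg * dj := mul_le_mul_of_nonneg_right hMg hdj
  have h2 : 0 ≤ Mg * c₁ := mul_nonneg (hMc0.trans hMg) hc₁
  nlinarith

/-- **(G1) AT ONE VOLUME.** On the exactly-tiled range (`McGuard`, `recordK₀ ≤ K`), with `Mg ≥ Mc`, `c₁ ≥ 0`, an inner window `Nin ≤ recordRNat` and a separation `Rsep` with
`Rsep + Nin∕2 + 2Mc ≤ recordR`: every domain of the wrap class `recordWrapCtr` is LARGE-OR-FAR from every inner-window label,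
`Rsep ≤ dist(e K μ z, X) + Mg·(d_j(X) + c₁)`.  (A seam cube is small but far; a long domain reaching the window is near but large.) [cite: Balaban1987RG1, §0 p.257, (1.21) p.264, (1.7) p.261] -/
theorem largeOrFar_of_mem_recordWrapCtr {Mc k K : ℕ} (hMc : McGuard F Mc) (hK : recordK₀ F Mc k ≤ K) {Mg c₁ : ℝ} (hMg : (Mc : ℝ) ≤ Mg) (hc₁ : 0 ≤ c₁)
    {Nin : ℕ} {Rsep : ℝ} (hNin : Nin ≤ recordRNat F Mc k K) (hRsep : Rsep + (Nin : ℝ) / 2 + 2 * Mc ≤ recordR F Mc k K)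
    (X : (recordDomSys F Mc k K).Dom) (hX : X ∈ recordWrapCtr F Mc k K) (μ : Fin 4) (z : Fin 4 → ℤ) (hz : ∀ l, 2 * |z l| < (Nin : ℤ)) :
    Rsep ≤ (recordSiteGeom F Mc k K).distD (recordE F k K μ z) X + Mg * ((recordDomSys F Mc k K).dj X + c₁) := by
  obtain ⟨c, hc, i, hi⟩ := (mem_recordWrapCtr_iff F Mc k K X).1 hX
  set i' : Fin 4 := Fin.cast (F.P_d K) i with hi'
  have hzN : 2 * |z i'| < (recordN F k K : ℤ) := by
    have h := hz i'
    have : (Nin : ℤ) ≤ recordN F k K := by exact_mod_cast hNin.trans (recordRNat_le_recordN hMc hK)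
    omega
  have hD : (((Sect2.domCount (F.P K) Mc (k + 1) / 2 : ℕ) : ℤ)) ≤ pabs (c i) := (pabs_eq_half_of_valMinAbs_eq (c i) hi).ge
  have hcore := mul_le_distD_of_far_cube_coord hMc hK X hc i hD μ z hzN
  rw [← recordR_eq_mul] at hcore
  exact largeOrFar_arith hMg hc₁ ((recordDomSys F Mc k K).dj_nonneg X) hRsep (two_mul_abs_cast_add_one_le (hz i')) hcore

/-- **(G1) OF `kstep_joinT_at_record`, AT THE RECORD** (member `n` = volume `recordK₀ F Mc k + n`): for an admissible letter `Mc`, `Mg ≥ Mc`, `c₁ ≥ 0`, any inner window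
`Nin k n ≤ recordRNat` and any separation with `Rsep k n + Nin k n ∕ 2 + 2Mc ≤ recordR`, the wrap-class row (G1) holds verbatim. [cite: Balaban1987RG1, §0 p.257, (1.21) p.264, (1.7) p.261] -/
theorem rowG1_largeOrFar_wrap (F : T4Family) {Mc : ℕ} (hMc : McGuard F Mc) {Mg c₁ : ℝ} (hMg : (Mc : ℝ) ≤ Mg) (hc₁ : 0 ≤ c₁)
    (Nin : ℕ → ℕ → ℕ) (Rsep : ℕ → ℕ → ℝ) (hNin : ∀ k n, Nin k n ≤ recordRNat F Mc k (recordK₀ F Mc k + n))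
    (hRsep : ∀ k n, Rsep k n + (Nin k n : ℝ) / 2 + 2 * Mc ≤ recordR F Mc k (recordK₀ F Mc k + n)) :
    ∀ (k n : ℕ) (X : (recordDomSys F Mc k (recordK₀ F Mc k + n)).Dom), X ∈ recordWrapCtr F Mc k (recordK₀ F Mc k + n) →
      ∀ (μ : Fin 4) (z : Fin 4 → ℤ), (∀ l, 2 * |z l| < (Nin k n : ℤ)) →
        Rsep k n ≤ (recordSiteGeom F Mc k (recordK₀ F Mc k + n)).distD (recordE F k (recordK₀ F Mc k + n) μ z) X +
          Mg * ((recordDomSys F Mc k (recordK₀ F Mc k + n)).dj X + c₁) :=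
  fun k n X hX μ z hz => largeOrFar_of_mem_recordWrapCtr hMc (Nat.le_add_right _ _) hMg hc₁ (hNin k n) (hRsep k n) X hX μ z hz

/-! ## §7  (G2) THE INTERIOR-PREIMAGE LEMMA AND THE NON-IMAGE DOMAINS OF MEMBER `n + 1` -/

/-- **INTERIOR PREIMAGE** (every volume, no tiling guard). A domain `X′ ∈ 𝐃_{k+1}(T_{K+1})` all of whose cube indices have minimal representatives STRICTLY INSIDE the centred
window of `T_K` off its seam (`−q < 2v ≤ q`, `v ≠ ⌊q∕2⌋`, `q` = cubes per direction of `T_K`) IS the centred image `recordDomEmbCtr X` of a non-wrap domain `X ∈ 𝐃_{k+1}(T_K)`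
(its coordinatewise `valMinAbs`-projection: wall-connected because `valMinAbs` commutes with `+1` off the antipodal value, off the seam by hypothesis, and lifted back
identically by `ZMod.coe_valMinAbs`). [cite: Balaban1987RG1, p.257 (connected families of cubes), (1.21) p.264] -/
theorem exists_recordDomEmbCtr_eq_of_interior {Mc k K : ℕ} (X' : (recordDomSys F Mc k (K + 1)).Dom)
    (hin : ∀ c ∈ (X'.1 : Finset _), ∀ i, -(Sect2.domCount (F.P K) Mc (k + 1) : ℤ) < 2 * (c i).valMinAbs ∧
      2 * (c i).valMinAbs ≤ Sect2.domCount (F.P K) Mc (k + 1) ∧ (c i).valMinAbs ≠ ((Sect2.domCount (F.P K) Mc (k + 1) / 2 : ℕ) : ℤ)) :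
    ∃ X : (recordDomSys F Mc k K).Dom, X ∉ recordWrapCtr F Mc k K ∧ recordDomEmbCtr F Mc k K X = X' := by
  classical
  have hqq' := K0AxJoinTGeomA.domCount_le_domCount_succ F Mc k K
  set q := Sect2.domCount (F.P K) Mc (k + 1) with hq
  set q' := Sect2.domCount (F.P (K + 1)) Mc (k + 1) with hq'
  set π : TPt (F.P (K + 1)).d q' → TPt (F.P K).d q := fun c i => (((c i).valMinAbs : ℤ) : ZMod q) with hπ
  have F1 : ∀ c ∈ (X'.1 : Finset _), ∀ i, (π c i).valMinAbs = (c i).valMinAbs := fun c hc i =>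
    (ZMod.valMinAbs_spec _ _).2 ⟨rfl, Set.mem_Ioc.2 ⟨by have := (hin c hc i).1; linarith, by have := (hin c hc i).2.1; linarith⟩⟩
  have F2 : ∀ c ∈ (X'.1 : Finset _), liftCubeCtr F Mc k K (π c) = c := fun c hc => by
    funext i
    simp only [liftCubeCtr]
    rw [F1 c hc i]
    exact ZMod.coe_valMinAbs (c i)
  have F3 : ∀ c ∈ (X'.1 : Finset _), ¬ OnSeamCtr (π c) := fun c hc => by
    rw [not_onSeamCtr_iff]
    intro i
    rw [F1 c hc i]
    exact (hin c hc i).2.2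
  have U : ∀ c ∈ (X'.1 : Finset _), ∀ i, π (Function.update c i (c i + 1)) = Function.update (π c) i (π c i + 1) := fun c hc i => by
    funext j
    have h := Function.apply_update (fun (_ : Fin (F.P (K + 1)).d) (x : ZMod q') => ((x.valMinAbs : ℤ) : ZMod q)) c i (c i + 1) j
    have hne : (c i).valMinAbs ≠ ((q' / 2 : ℕ) : ℤ) := by
      have h1 := (hin c hc i).2.1
      have h2 := (hin c hc i).2.2
      have h3 : (q : ℤ) ≤ q' := by exact_mod_cast hqq'
      omega
    simp only [hπ]
    rw [h, valMinAbs_add_one_of_ne_half _ hne, Int.cast_add, Int.cast_one]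
    rfl
  have F4 : ∀ c ∈ (X'.1 : Finset _), ∀ c'' ∈ (X'.1 : Finset _), TAdj c c'' → TAdj (π c) (π c'') := fun c hc c'' hc'' h => by
    obtain ⟨i, h | h⟩ := h
    · exact ⟨i, Or.inl (by rw [h, U c hc i])⟩
    · exact ⟨i, Or.inr (by rw [h, U c'' hc'' i])⟩
  have hconn : IsTDom ((X'.1 : Finset _).image π) := by
    refine ⟨X'.2.1.image _, ?_⟩
    intro x hx y hy
    obtain ⟨a, ha, rfl⟩ := Finset.mem_image.1 hx
    obtain ⟨b, hb, rfl⟩ := Finset.mem_image.1 hy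
    have hab : TLinked (X'.1 : Finset _) a b := X'.2.2 a ha b hb
    unfold TLinked at hab ⊢
    exact Relation.ReflTransGen.lift π
      (fun u v huv => ⟨Finset.mem_image_of_mem _ huv.1, Finset.mem_image_of_mem _ huv.2.1, F4 u huv.1 v huv.2.1 huv.2.2⟩) a b hab
  refine ⟨⟨(X'.1 : Finset _).image π, hconn⟩, ?_, ?_⟩
  · intro hw
    obtain ⟨c₀, hc₀, hs⟩ := (mem_recordWrapCtr_iff F Mc k K _).1 hw
    obtain ⟨c, hc, rfl⟩ := Finset.mem_image.1 hc₀
    exact F3 c hc hs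
  · have hnot : (⟨(X'.1 : Finset _).image π, hconn⟩ : (recordDomSys F Mc k K).Dom) ∉ recordWrapCtr F Mc k K := by
      intro hw
      obtain ⟨c₀, hc₀, hs⟩ := (mem_recordWrapCtr_iff F Mc k K _).1 hw
      obtain ⟨c, hc, rfl⟩ := Finset.mem_image.1 hc₀
      exact F3 c hc hs
    apply Subtype.ext
    rw [recordDomEmbCtr_val_of_not_mem F Mc k K _ hnot]
    show ((X'.1 : Finset _).image π).image (liftCubeCtr F Mc k K) = X'.1
    rw [Finset.image_image]
    ext c
    simp only [Finset.mem_image, Function.comp_apply]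
    constructor
    · rintro ⟨c', hc', rfl⟩
      rw [F2 c' hc']
      exact hc'
    · intro hc
      exact ⟨c, hc, F2 c hc⟩

/-- **A NON-IMAGE DOMAIN OWNS A FAR CUBE**: if `X′ ∈ 𝐃_{k+1}(T_{K+1})` is not the centred image of any non-wrap domain of `T_K`, some cube of `X′` has a coordinate at torus distance
`≥ ⌊q∕2⌋` from `0` (`q` = cubes per direction of `T_K`). [cite: Balaban1987RG1, p.257, (1.21) p.264] -/
theorem exists_far_cube_of_not_image {Mc k K : ℕ} (X' : (recordDomSys F Mc k (K + 1)).Dom)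
    (hX' : ∀ X, X ∉ recordWrapCtr F Mc k K → recordDomEmbCtr F Mc k K X ≠ X') :
    ∃ c ∈ (X'.1 : Finset _), ∃ i, ((Sect2.domCount (F.P K) Mc (k + 1) / 2 : ℕ) : ℤ) ≤ pabs (c i) := by
  by_contra h
  push Not at h
  refine (exists_recordDomEmbCtr_eq_of_interior X' fun c hc i => ?_).elim fun X hX => hX' X hX.1 hX.2
  have hlt := h c hc i
  unfold pabs at hlt
  have h1 := le_abs_self (c i).valMinAbs
  have h2 := neg_abs_le (c i).valMinAbs
  refine ⟨by omega, by omega, fun heq => ?_⟩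
  rw [heq, abs_of_nonneg (Int.natCast_nonneg _)] at hlt
  exact lt_irrefl _ hlt

/-- **(G2) AT ONE VOLUME STEP.** On the exactly-tiled range, with `Mg ≥ Mc`, `c₁ ≥ 0`, `Nin ≤ recordRNat(K)`, `Rsep + Nin∕2 + 2Mc ≤ recordR(K)`: every domain of `T_{K+1}` that is NOT
the centred image of a non-wrap domain of `T_K` is LARGE-OR-FAR from every inner-window label of `T_{K+1}`. [cite: Balaban1987RG1, §0 p.257, (1.21) p.264, (1.7) p.261] -/
theorem largeOrFar_of_not_image {Mc k K : ℕ} (hMc : McGuard F Mc) (hK : recordK₀ F Mc k ≤ K) {Mg c₁ : ℝ} (hMg : (Mc : ℝ) ≤ Mg) (hc₁ : 0 ≤ c₁)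
    {Nin : ℕ} {Rsep : ℝ} (hNin : Nin ≤ recordRNat F Mc k K) (hRsep : Rsep + (Nin : ℝ) / 2 + 2 * Mc ≤ recordR F Mc k K)
    (X' : (recordDomSys F Mc k (K + 1)).Dom) (hX' : ∀ X, X ∉ recordWrapCtr F Mc k K → recordDomEmbCtr F Mc k K X ≠ X')
    (μ : Fin 4) (z : Fin 4 → ℤ) (hz : ∀ l, 2 * |z l| < (Nin : ℤ)) :
    Rsep ≤ (recordSiteGeom F Mc k (K + 1)).distD (recordE F k (K + 1) μ z) X' + Mg * ((recordDomSys F Mc k (K + 1)).dj X' + c₁) := by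
  obtain ⟨c, hc, i, hD⟩ := exists_far_cube_of_not_image X' hX'
  have hK1 : recordK₀ F Mc k ≤ K + 1 := Nat.le_succ_of_le hK
  set i' : Fin 4 := Fin.cast (F.P_d (K + 1)) i with hi'
  have hzN : 2 * |z i'| < (recordN F k (K + 1) : ℤ) := by
    have h := hz i'
    have : (Nin : ℤ) ≤ recordN F k (K + 1) := by
      exact_mod_cast hNin.trans ((recordRNat_le_recordN hMc hK).trans (recordN_le_succ (succ_le_of_recordK₀_le hK)))
    omega
  have hcore := mul_le_distD_of_far_cube_coord hMc hK1 X' hc i hD μ z hzN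
  rw [← recordR_eq_mul] at hcore
  exact largeOrFar_arith hMg hc₁ ((recordDomSys F Mc k (K + 1)).dj_nonneg X') hRsep (two_mul_abs_cast_add_one_le (hz i')) hcore

/-- **(G2) OF `kstep_joinT_at_record`, AT THE RECORD** (member `n + 1` = volume `recordK₀ F Mc k + (n + 1)`): for an admissible letter `Mc`, `Mg ≥ Mc`, `c₁ ≥ 0`, any inner
window `Nin k n ≤ recordRNat` and any separation with `Rsep k n + Nin k n ∕ 2 + 2Mc ≤ recordR`, the non-image row (G2) holds verbatim. [cite: Balaban1987RG1, §0 p.257, (1.21) p.264, (1.7) p.261] -/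
theorem rowG2_largeOrFar_notImage (F : T4Family) {Mc : ℕ} (hMc : McGuard F Mc) {Mg c₁ : ℝ} (hMg : (Mc : ℝ) ≤ Mg) (hc₁ : 0 ≤ c₁)
    (Nin : ℕ → ℕ → ℕ) (Rsep : ℕ → ℕ → ℝ) (hNin : ∀ k n, Nin k n ≤ recordRNat F Mc k (recordK₀ F Mc k + n))
    (hRsep : ∀ k n, Rsep k n + (Nin k n : ℝ) / 2 + 2 * Mc ≤ recordR F Mc k (recordK₀ F Mc k + n)) :
    ∀ (k n : ℕ) (X' : (recordDomSys F Mc k (recordK₀ F Mc k + (n + 1))).Dom),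
      (∀ X, X ∉ recordWrapCtr F Mc k (recordK₀ F Mc k + n) → recordDomEmbCtr F Mc k (recordK₀ F Mc k + n) X ≠ X') →
      ∀ (μ : Fin 4) (z : Fin 4 → ℤ), (∀ l, 2 * |z l| < (Nin k n : ℤ)) →
        Rsep k n ≤
          (recordSiteGeom F Mc k (recordK₀ F Mc k + (n + 1))).distD (recordE F k (recordK₀ F Mc k + (n + 1)) μ z) X' +
            Mg * ((recordDomSys F Mc k (recordK₀ F Mc k + (n + 1))).dj X' + c₁) :=
  fun k n X' hX' μ z hz => largeOrFar_of_not_image hMc (Nat.le_add_right _ _) hMg hc₁ (hNin k n) (hRsep k n) X' hX' μ z hz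

/-! ## §8  THE RECORD CHOICE `Nin := recordRNat`, `Rsep := recordR ∕ 2 − 2Mc` (◆ CRIT-1 g36 (D), ★★★ director-ym №535) -/

/-- The record choice meets the separation budget EXACTLY: `(recordR∕2 − 2Mc) + recordRNat∕2 + 2Mc = recordR`. [cite: Balaban1987RG1, (1.21) p.264 (bookkeeping)] -/
theorem recordChoice_budget (Mc k K : ℕ) :
    recordR F Mc k K / 2 - 2 * Mc + (recordRNat F Mc k K : ℝ) / 2 + 2 * Mc ≤ recordR F Mc k K := by
  rw [← recordR_eq_cast_recordRNat]
  linarith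

/-- **(G1) AT THE RECORD CHOICE** `Nin k n := recordRNat F Mc k (recordK₀ F Mc k + n)`, `Rsep k n := recordR F Mc k (recordK₀ F Mc k + n) ∕ 2 − 2Mc` (`Mg ≥ Mc`, `c₁ ≥ 0`,
`McGuard F Mc`). [cite: Balaban1987RG1, §0 p.257, (1.21) p.264, (1.7) p.261] -/
theorem rowG1_at_recordChoice (F : T4Family) {Mc : ℕ} (hMc : McGuard F Mc) {Mg c₁ : ℝ} (hMg : (Mc : ℝ) ≤ Mg) (hc₁ : 0 ≤ c₁) :
    ∀ (k n : ℕ) (X : (recordDomSys F Mc k (recordK₀ F Mc k + n)).Dom), X ∈ recordWrapCtr F Mc k (recordK₀ F Mc k + n) →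
      ∀ (μ : Fin 4) (z : Fin 4 → ℤ), (∀ l, 2 * |z l| < (recordRNat F Mc k (recordK₀ F Mc k + n) : ℤ)) →
        recordR F Mc k (recordK₀ F Mc k + n) / 2 - 2 * Mc ≤
          (recordSiteGeom F Mc k (recordK₀ F Mc k + n)).distD (recordE F k (recordK₀ F Mc k + n) μ z) X +
            Mg * ((recordDomSys F Mc k (recordK₀ F Mc k + n)).dj X + c₁) :=
  rowG1_largeOrFar_wrap F hMc hMg hc₁ (fun k n => recordRNat F Mc k (recordK₀ F Mc k + n)) (fun k n => recordR F Mc k (recordK₀ F Mc k + n) / 2 - 2 * Mc)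
    (fun _ _ => le_rfl) (fun k n => recordChoice_budget Mc k (recordK₀ F Mc k + n))

/-- **(G2) AT THE RECORD CHOICE** `Nin k n := recordRNat F Mc k (recordK₀ F Mc k + n)`, `Rsep k n := recordR F Mc k (recordK₀ F Mc k + n) ∕ 2 − 2Mc` (`Mg ≥ Mc`, `c₁ ≥ 0`,
`McGuard F Mc`). [cite: Balaban1987RG1, §0 p.257, (1.21) p.264, (1.7) p.261] -/
theorem rowG2_at_recordChoice (F : T4Family) {Mc : ℕ} (hMc : McGuard F Mc) {Mg c₁ : ℝ} (hMg : (Mc : ℝ) ≤ Mg) (hc₁ : 0 ≤ c₁) :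
    ∀ (k n : ℕ) (X' : (recordDomSys F Mc k (recordK₀ F Mc k + (n + 1))).Dom),
      (∀ X, X ∉ recordWrapCtr F Mc k (recordK₀ F Mc k + n) → recordDomEmbCtr F Mc k (recordK₀ F Mc k + n) X ≠ X') →
      ∀ (μ : Fin 4) (z : Fin 4 → ℤ), (∀ l, 2 * |z l| < (recordRNat F Mc k (recordK₀ F Mc k + n) : ℤ)) →
        recordR F Mc k (recordK₀ F Mc k + n) / 2 - 2 * Mc ≤
          (recordSiteGeom F Mc k (recordK₀ F Mc k + (n + 1))).distD (recordE F k (recordK₀ F Mc k + (n + 1)) μ z) X' +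
            Mg * ((recordDomSys F Mc k (recordK₀ F Mc k + (n + 1))).dj X' + c₁) :=
  rowG2_largeOrFar_notImage F hMc hMg hc₁ (fun k n => recordRNat F Mc k (recordK₀ F Mc k + n)) (fun k n => recordR F Mc k (recordK₀ F Mc k + n) / 2 - 2 * Mc)
    (fun _ _ => le_rfl) (fun k n => recordChoice_budget Mc k (recordK₀ F Mc k + n))

/-! ## §9  ★★★ THE FIT, KERNEL-CHECKED: `kstep_joinT_at_record` with hands α AND β's rows discharged at the record choices -/

section KStepDischarged

open scoped Topology
open Literature.MathematicalPhysics.QuantumFieldTheory.Balaban1983to89.FlowStep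
open Literature.MathematicalPhysics.QuantumFieldTheory.Balaban1983to89.FlowStepRuns
open Summit.QuantumFields.YangMills.Theorems.K0AxTwoVolumeRate (RecordPvolTwoVolExpOnRunsAx)
open Summit.QuantumFields.YangMills.Theorems.K0AxJoinTGeomA (kstep_joinT_at_record_geomA)

/-- ★★★ **`kstep_joinT_at_record` WITH THE FIVE GEOMETRY ROWS (G0)–(G4) DISCHARGED** — hand α's ✓`kstep_joinT_at_record_geomA` (`Nin k n := recordRNat F Mc k (recordK₀ F Mc k + n)`,
`Rsep k n := recordR F Mc k (recordK₀ F Mc k + n) ∕ 2 − 2·Mc`, `cR := 1∕16`, admissible letter `McGuard F Mc`) with its two displayed LARGE-OR-FAR rows (G1)(G2) SUPPLIED by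
`rowG1_at_recordChoice ∕ rowG2_at_recordChoice` under the guards `Mc ≤ Mg` and `0 ≤ c₁` on the two free letters of ★★★'s mask (the director's record choice `Mg ≥ 4·Mc` is a special case).  What remains displayed, verbatim: D1 (⁸'s
`FormatPlusG` mould at `recordEmbJ` on `]0, γ₀]`-runs), the swap row to `ιC`, D9 `Response9DAtJC` + the D13 identities, the leaves (cube-sum at `δ₀∕4`, tree at `κ∕4`)
⟹ [E] `RecordPvolTwoVolExpOnRunsAx F a₀ ε₂₉ γ₀ (48E₀C₉²K₀′K₁ + 32E₀C₉²e^{δ₁Mg c₁}K₀′K₁) (δ₁ ∕ 16)`, `δ₁ = delta1 δ₀ κ Mg`.  CONDITIONAL over the displayed rows (D1, D9's decay,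
D13 via P0 are OPEN content); nothing of Bałaban asserted; K0ᴬ 27238 OPEN; the Yang–Mills mass gap is NOT proved.
[cite: Balaban1987RG1, Thm 1 p.259, (0.20) p.256, (1.7) p.261, (1.18)–(1.22) pp.263–264, (4.4)–(4.5) pp.281–282, (4.14) p.284, (4.35)–(4.37) pp.290–291; Balaban1985Variational, Prop. 9 p.309] -/
theorem kstep_joinT_at_record_geomAB {E₀ κ C₉ δ₀ Mg c₁ K₀' K₁ : ℝ}
    (hE₀ : 0 ≤ E₀) (hκ : 0 < κ) (hC₉ : 0 ≤ C₉) (hδ₀ : 0 < δ₀) (hMg : 0 < Mg) (hc₁ : 0 ≤ c₁) (hK₀' : 0 ≤ K₀') :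
    ∀ (F : T4Family) (a₀ ε₂₉ γ₀ α₀ α₁ : ℝ), 0 < α₀ → 0 < α₁ → ∀ (Mc : ℕ), McGuard F Mc → (Mc : ℝ) ≤ Mg →
      letI θ := thetaFill F a₀ ε₂₉; letI := θ.instVβ₁; letI := θ.instVβ₂; letI := θ.instιβ
      ∀ ιC : (k n : ℕ) → recordW F a₀ ε₂₉ k (recordK₀ F Mc k + n) → (Fin (recordChartDimJ F (recordK₀ F Mc k + n)) → ℂ),
      (∀ (k : ℕ) (g : ℕ → ℝ), FlowStep.RGEqH k (betaOfRecord₁₃Ax F 2 (thetaFill F a₀ ε₂₉)) g → Step.InInterval γ₀ k g →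
        B12FormatPlus.FormatPlusG (fun n => recordDomSys F Mc k (recordK₀ F Mc k + n)) (fun n => recordBondCount F (recordK₀ F Mc k + n))
          (fun n => recordAct F (recordK₀ F Mc k + n)) (fun n => recordUc F Mc k α₀ α₁ (recordK₀ F Mc k + n))
          (fun n => recordCoords F Mc k (recordK₀ F Mc k + n)) (fun n => recordChartDimJ F (recordK₀ F Mc k + n))
          (fun n => recordChartJ F Mc k (recordK₀ F Mc k + n)) (fun n => recordΦfAx F a₀ ε₂₉ k (FlowStep.prefixOf g k) (recordK₀ F Mc k + n))
          (fun n => recordEmbJ F θ k (recordK₀ F Mc k + n)) (fun n => recordWrapCtr F Mc k (recordK₀ F Mc k + n))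
          (fun n => recordDomEmbCtr F Mc k (recordK₀ F Mc k + n)) (fun n _ => recordCoordProjCtr F (recordK₀ F Mc k + n)) E₀ κ) →
      (∀ (k n : ℕ), ∀ᶠ B in 𝓝 (0 : recordW F a₀ ε₂₉ k (recordK₀ F Mc k + n)), ∀ X : (recordDomSys F Mc k (recordK₀ F Mc k + n)).Dom,
          ∃ g : recordGaugeGrp F (recordK₀ F Mc k + n), ∀ i ∈ recordCoords F Mc k (recordK₀ F Mc k + n) X,
            recordChartJ F Mc k (recordK₀ F Mc k + n) X (ιC k n B) i =
              recordAct F (recordK₀ F Mc k + n) g (recordChartJ F Mc k (recordK₀ F Mc k + n) X (recordEmbJ F θ k (recordK₀ F Mc k + n) B)) i) →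
      (∀ k : ℕ, (∀ a : θ.ιβ, Response9DAtJC F θ a Mc k (recordK₀ F Mc k) (min (1 / 4 : ℝ) (min α₁ (α₀ / 36))) C₉ δ₀) ∧
          (∀ n : ℕ, ContDiffAt ℝ 2 (ιC k n) 0 ∧ ιC k n 0 = 0) ∧
          ∀ (n : ℕ) (a : θ.ιβ) (l : RespLabel F k (recordK₀ F Mc k + n)),
            recordGkJC F θ k (recordK₀ F Mc k + n) a l = fun i => fderiv ℝ (ιC k n) 0 (Pi.single l.1 (Pi.single l.2 (θ.bV a))) i) →
      (∀ k n : ℕ, B12Decay510.CubeSumLeaf (recordSiteGeom F Mc k (recordK₀ F Mc k + n)) (δ₀ / 4) K₁ ∧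
          B12Decay510.TreeLeaf (recordCc F Mc k (recordK₀ F Mc k + n)) (κ / 4) K₀') →
      RecordPvolTwoVolExpOnRunsAx F a₀ ε₂₉ γ₀
        (48 * E₀ * C₉ ^ 2 * K₀' * K₁ + 32 * E₀ * C₉ ^ 2 * Real.exp (B12Decay510.delta1 δ₀ κ Mg * Mg * c₁) * K₀' * K₁)
        (B12Decay510.delta1 δ₀ κ Mg * (1 / 16)) := by
  intro F a₀ ε₂₉ γ₀ α₀ α₁ hα₀ hα₁ Mc hMc hMgMc ιC h8 hsw h9 hleaf
  exact kstep_joinT_at_record_geomA hE₀ hκ hC₉ hδ₀ hMg hK₀' F a₀ ε₂₉ γ₀ α₀ α₁ hα₀ hα₁ Mc hMc ιC h8 hsw h9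
    (rowG1_at_recordChoice F hMc hMgMc hc₁) (rowG2_at_recordChoice F hMc hMgMc hc₁) hleaf

end KStepDischarged

end Summit.QuantumFields.YangMills.Theorems.K0AxJoinTGeomB

end
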